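import Mathlib.NumberTheory.NumberField.Basic
import Mathlib.NumberTheory.RamificationInertia.Valuation
import Mathlib.NumberTheory.RamificationInertia.Basic
import Mathlib.RingTheory.RamificationInertia.Ramification
import Mathlib.RingTheory.Polynomial.Eisenstein.Basic
import Mathlib.RingTheory.DedekindDomain.AdicValuation
import Mathlib.RingTheory.Polynomial.GaussLemma
import Mathlib.RingTheory.AdjoinRoot
import HarnessLib

/-!
# Extensions of a number field of prescribed degree, totally ramified at prescribed primes

Trunk T-ELLARITH (`NumberTheory/EllipticCurves`). D-0014 decomposition file, bottom layer under
the named fact `Literature.NumberTheory.EllipticCurves.ClarkSharif2010_exists_totallyRamified` of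
`Literature/NumberTheory/EllipticCurves/PeriodIndex` (P. L. Clark, S. Sharif, *Period, index and
potential. III*, Algebra Number Theory 4 (2010), §3.7, proof of Theorem 3: "For each `v_i ∈ S_r`,
let `L_i/K_{v_i}` be a totally ramified extension of degree `P`. There exists a degree `P` global
extension `L = L(r)` of `K` such that for all `v_i ∈ S_r`, `L ⊗_K K_{v_i} ≅ L_i`", with
footnote 3: "This is a standard weak approximation / Krasner's Lemma argument"). This file PROVES
the statement of that fact, by the textbook Eisenstein construction instead of Krasner's lemma:

* `Literature.NumberTheory.EllipticCurves.exists_forall_mem_and_notMem_sq`: in a Dedekind domain, for a finite set `T` of nonzero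
  primes there is an element `a` with `a ∈ v ∖ v²` (i.e. `ord_v(a) = 1`) for every `v ∈ T`
  (Chinese remainder theorem, Mathlib `IsDedekindDomain.exists_forall_sub_mem_ideal`, applied to
  uniformisers modulo `v²`);
* `Literature.NumberTheory.EllipticCurves.irreducible_X_pow_add_C_of_mem_of_notMem_sq`: `X^P + a` is then Eisenstein at any such
  `v`, hence irreducible over `K = Frac` (Mathlib `Polynomial.IsEisensteinAt.irreducible` and
  Gauss's lemma `Polynomial.Monic.irreducible_iff_irreducible_map_fraction_map`);
* `Literature.NumberTheory.EllipticCurves.ramificationIdx_eq_of_pow_eq`: if `[L : K] = P`, `α ∈ L` satisfies `α^P = a` with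
  `ord_v(a) = 1`, then every prime `w` of `L` above `v` has ramification index `e(w|v) = P`:
  `P · ord_w(α) = ord_w(a) = e(w|v) · ord_v(a) = e(w|v)` (Mathlib
  `IsDedekindDomain.HeightOneSpectrum.valuation_liesOver`), so `P ∣ e(w|v)`, while
  `e(w|v) ≤ [L : K] = P` (Mathlib `Ideal.ramificationIdx_le_finrank`);
* `Literature.NumberTheory.EllipticCurves.exists_extension_totallyRamified`: for a number field `K`, a finite set `T` of finite
  places and `P > 0` there is a number field `L ⊇ K` with `[L : K] = P` in which every `v ∈ T`
  is totally ramified (`e(w|v) = P` for every `w ∣ v`): `L = K(α)`, `α^P = -a` with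
  `ord_v(a) = 1` for all `v ∈ T` and for one auxiliary prime `v₀` (so that the polynomial is
  Eisenstein somewhere even if `T = ∅`), Mathlib `AdjoinRoot`.

Everything here is proved (elementary algebraic number theory on Mathlib's Dedekind-domain API;
no source is needed beyond the statement being discharged); the statement proved is literally
the body of `Literature.NumberTheory.EllipticCurves.ClarkSharif2010_exists_totallyRamified`, whose discharge
`ClarkSharif2010_exists_totallyRamified_holds` is a one-liner in the sibling file
`PeriodIndexProofs` (kept there because this file does not import `PeriodIndex`).

## References

* P. L. Clark, S. Sharif, Algebra Number Theory 4 (2010) 151–174, §3.7 with footnote 3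
  (`ClarkSharif2010`).
-/

noncomputable section

open scoped Classical Polynomial

open NumberField IsDedekindDomain WithZero Polynomial

universe u

namespace Literature.NumberTheory.EllipticCurves

/-! ### An element of order exactly one at finitely many primes -/

section CRT

variable {R : Type u} [CommRing R] [IsDedekindDomain R]

/-- **Simultaneous uniformiser.** In a Dedekind domain, for a finite set `T` of nonzero primes
there is an element `a` with `a ∈ v` and `a ∉ v²` (`ord_v(a) = 1`) for every `v ∈ T`: choose
`π_v ∈ v ∖ v²` and solve `a ≡ π_v (mod v²)` by the Chinese remainder theorem. [folklore] -/
theorem exists_forall_mem_and_notMem_sq (T : Finset (HeightOneSpectrum R)) :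
    ∃ a : R, ∀ v ∈ T, a ∈ v.asIdeal ∧ a ∉ v.asIdeal ^ 2 := by
  have hπ : ∀ v : HeightOneSpectrum R, ∃ π : R, π ∈ v.asIdeal ∧ π ∉ v.asIdeal ^ 2 := by
    intro v
    have hlt : v.asIdeal ^ 2 < v.asIdeal ^ 1 :=
      Ideal.pow_right_strictAnti v.asIdeal v.ne_bot v.isPrime.ne_top (by norm_num)
    rw [pow_one] at hlt
    obtain ⟨π, hπ, hπ2⟩ := SetLike.exists_of_lt hlt
    exact ⟨π, hπ, hπ2⟩
  choose π hπ using hπ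
  obtain ⟨a, ha⟩ := IsDedekindDomain.exists_forall_sub_mem_ideal (s := T) (fun v ↦ v.asIdeal)
    (fun _ ↦ 2) (fun v _ ↦ v.prime) (fun v _ w _ hvw ↦ fun h ↦ hvw (HeightOneSpectrum.ext h))
    (fun v ↦ π v)
  refine ⟨a, fun v hv ↦ ?_⟩
  have hsub : a - π v ∈ v.asIdeal ^ 2 := ha v hv
  refine ⟨?_, fun ha2 ↦ (hπ v).2 ?_⟩
  · have : a - π v ∈ v.asIdeal := Ideal.pow_le_self two_ne_zero hsub
    simpa using v.asIdeal.add_mem this (hπ v).1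
  · have := v.asIdeal ^ 2 |>.sub_mem ha2 hsub
    simpa using this

/-- `ord_v(a) = 1` in valuation form: `a ∈ v ∖ v²` iff the `v`-adic valuation of `a` is
`exp (-1)`. [folklore] -/
theorem intValuation_eq_exp_neg_one {v : HeightOneSpectrum R} {a : R} (ha : a ∈ v.asIdeal)
    (ha2 : a ∉ v.asIdeal ^ 2) : v.intValuation a = exp (-1 : ℤ) := by
  have ha0 : a ≠ 0 := by rintro rfl; exact ha2 (Submodule.zero_mem _)
  apply le_antisymm
  · have := (v.intValuation_le_pow_iff_mem a 1).mpr (by simpa using ha)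
    simpa using this
  · have h2 : ¬ v.intValuation a ≤ exp (-(2 : ℕ) : ℤ) :=
      fun h ↦ ha2 ((v.intValuation_le_pow_iff_mem a 2).mp h)
    rw [not_le, v.intValuation_if_neg ha0, exp_lt_exp] at h2
    rw [v.intValuation_if_neg ha0, exp_le_exp]
    omega

end CRT

/-! ### Eisenstein polynomials `X^P + a` and the ramification of `K(a^{1/P})` -/

section NumberField

variable {K : Type u} [Field K] [NumberField K]

/-- A number field has a finite place (its ring of integers is not a field). [folklore] -/
theorem exists_heightOneSpectrum : ∃ _v : HeightOneSpectrum (𝓞 K), True := by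
  obtain ⟨I, hbot, htop⟩ := (Ring.not_isField_iff_exists_ideal_bot_lt_and_lt_top).mp
    (RingOfIntegers.not_isField K)
  obtain ⟨M, hM, hIM⟩ := Ideal.exists_le_maximal I htop.ne
  exact ⟨⟨M, hM.isPrime, fun h ↦ lt_irrefl ⊥ (h ▸ hbot.trans_le hIM)⟩, trivial⟩

/-- **Eisenstein.** If `a ∈ v ∖ v²` for a finite place `v` of the number field `K` and `P > 0`,
then `X^P + a` is irreducible over `K`: it is Eisenstein at `v` over `𝓞 K`
(`Polynomial.IsEisensteinAt.irreducible`), and irreducibility passes to `K` by Gauss's lemma.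
[folklore] -/
theorem irreducible_X_pow_add_C_of_mem_of_notMem_sq {a : 𝓞 K} {P : ℕ} (hP : 0 < P)
    {v : HeightOneSpectrum (𝓞 K)} (ha : a ∈ v.asIdeal) (ha2 : a ∉ v.asIdeal ^ 2) :
    Irreducible ((X ^ P + C a : (𝓞 K)[X]).map (algebraMap (𝓞 K) K)) := by
  have hmonic : (X ^ P + C a : (𝓞 K)[X]).Monic := monic_X_pow_add_C a hP.ne'
  have hdeg : (X ^ P + C a : (𝓞 K)[X]).natDegree = P := natDegree_X_pow_add_C
  have heis : (X ^ P + C a : (𝓞 K)[X]).IsEisensteinAt v.asIdeal := by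
    refine ⟨?_, fun {n} hn ↦ ?_, ?_⟩
    · rw [hmonic.leadingCoeff]
      exact v.asIdeal.ne_top_iff_one.mp v.isPrime.ne_top
    · rw [hdeg] at hn
      rw [coeff_add, coeff_X_pow, coeff_C, if_neg hn.ne]
      split_ifs
      · simpa using ha
      · simp
    · rw [coeff_add, coeff_X_pow, coeff_C, if_neg (Nat.pos_iff_ne_zero.mp hP).symm, if_pos rfl,
        zero_add]
      exact ha2
  have hirr : Irreducible (X ^ P + C a : (𝓞 K)[X]) :=
    heis.irreducible v.isPrime hmonic.isPrimitive (by rw [hdeg]; exact hP)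
  exact (hmonic.irreducible_iff_irreducible_map_fraction_map (K := K)).mp hirr

/-- **Total ramification of a `P`-th root of a uniformiser.** Let `L/K` be number fields with
`[L : K] = P > 0`, `a ∈ 𝓞 K` with `a ∈ v ∖ v²` at the finite place `v`, and `α ∈ L` with
`α^P = a`. Then every place `w` of `L` above `v` has ramification index `e(w|v) = P` (so `v` is
totally ramified in `L`): taking `w`-adic valuations, `P · ord_w(α) = ord_w(a) = e(w|v) · ord_v(a)
= e(w|v)` (`IsDedekindDomain.HeightOneSpectrum.valuation_liesOver`), so `P ∣ e(w|v) ≠ 0`, and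
`e(w|v) ≤ [L : K] = P` (`Ideal.ramificationIdx_le_finrank`). [folklore] -/
theorem ramificationIdx_eq_of_pow_eq (L : Type u) [Field L] [NumberField L] [Algebra K L]
    {P : ℕ} (hP : 0 < P) (hdeg : Module.finrank K L = P) {a : 𝓞 K} {α : L}
    (hα : α ^ P = algebraMap K L (algebraMap (𝓞 K) K a)) (v : HeightOneSpectrum (𝓞 K))
    (ha : a ∈ v.asIdeal) (ha2 : a ∉ v.asIdeal ^ 2) (w : HeightOneSpectrum (𝓞 L))
    [w.asIdeal.LiesOver v.asIdeal] : w.asIdeal.ramificationIdx (𝓞 K) = P := by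
  haveI := w.isPrime
  haveI := v.isMaximal
  haveI : NoZeroSMulDivisors (𝓞 K) (𝓞 L) := ⟨fun h ↦ by
    by_contra hh
    push Not at hh
    exact hh.2 ((smul_eq_zero_iff_right hh.1).mp h)⟩
  have ha0 : a ≠ 0 := by rintro rfl; exact ha2 (Submodule.zero_mem _)
  have hva : v.intValuation a = exp (-1 : ℤ) := intValuation_eq_exp_neg_one ha ha2
  set e := v.asIdeal.ramificationIdx' w.asIdeal with he
  have hval : v.valuation K (algebraMap (𝓞 K) K a) ^ e = w.valuation L (α ^ P) := by
    rw [hα, ← HeightOneSpectrum.valuation_liesOver L v w]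
  rw [HeightOneSpectrum.valuation_of_algebraMap, hva, map_pow] at hval
  have hα0 : α ≠ 0 := by
    intro h
    rw [h, zero_pow hP.ne', eq_comm, map_eq_zero] at hα
    exact ha0 ((FaithfulSMul.algebraMap_eq_zero_iff (𝓞 K) K).mp hα)
  have hwα : w.valuation L α ≠ 0 := (Valuation.ne_zero_iff _).mpr hα0
  obtain ⟨z, hz⟩ : ∃ z : ℤ, w.valuation L α = exp z := ⟨_, (exp_log hwα).symm⟩
  rw [hz, ← exp_nsmul, ← exp_nsmul, exp_inj] at hval
  simp only [nsmul_eq_mul, mul_neg, mul_one] at hval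
  have hPe : (P : ℤ) ∣ e := ⟨-z, by linarith⟩
  have hPe' : P ∣ e := by exact_mod_cast hPe
  have he0 : e ≠ 0 :=
    Ideal.IsDedekindDomain.ramificationIdx'_ne_zero_of_liesOver w.asIdeal v.ne_bot
  have hle : e ≤ P := hdeg ▸ Ideal.ramificationIdx_le_finrank (𝓞 L) K L w.asIdeal
  have heP : e = P := le_antisymm hle (Nat.le_of_dvd (Nat.pos_of_ne_zero he0) hPe')
  rw [← Ideal.ramificationIdx'_eq_ramificationIdx v.asIdeal w.asIdeal v.ne_bot, ← he, heP]

/-- **A degree-`P` extension totally ramified at prescribed places.** For a number field `K`, a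
finite set `T` of finite places of `K` and `P > 0`, there is a number field `L ⊇ K` with
`[L : K] = P` such that every `v ∈ T` is totally ramified in `L`: every place `w` of `L` above
`v` has ramification index `e(w|v) = P = [L : K]` (hence is the unique place above `v`, with
residue degree `1`; equivalently `L ⊗_K K_v` is a totally ramified field extension of `K_v` of
degree `P`). Construction: `L = K[X]/(X^P + a)` with `ord_v(a) = 1` for all `v ∈ T` and at one
auxiliary place (`exists_forall_mem_and_notMem_sq`, `irreducible_X_pow_add_C_of_mem_of_notMem_sq`,
`ramificationIdx_eq_of_pow_eq`). This is the statement of the named fact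
`Literature.NumberTheory.EllipticCurves.ClarkSharif2010_exists_totallyRamified` (Clark–Sharif 2010, §3.7 with footnote 3: "There
exists a degree `P` global extension `L = L(r)` of `K` such that for all `v_i ∈ S_r`,
`L ⊗_K K_{v_i} ≅ L_i` [totally ramified of degree `P`] — a standard weak approximation /
Krasner's Lemma argument"). [cite: ClarkSharif2010, §3.7 with footnote 3] -/
theorem exists_extension_totallyRamified (T : Finset (HeightOneSpectrum (𝓞 K))) {P : ℕ}
    (hP : 0 < P) :
    ∃ (L : Type u) (_ : Field L) (_ : NumberField L) (_ : Algebra K L),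
      Module.finrank K L = P ∧
        ∀ v ∈ T, ∀ (w : HeightOneSpectrum (𝓞 L)) [w.asIdeal.LiesOver v.asIdeal],
          w.asIdeal.ramificationIdx (𝓞 K) = P := by
  -- an auxiliary place `v₀`, so that the polynomial is Eisenstein somewhere even if `T = ∅`
  obtain ⟨v₀, -⟩ := exists_heightOneSpectrum (K := K)
  obtain ⟨a, ha⟩ := exists_forall_mem_and_notMem_sq (insert v₀ T)
  set f : (𝓞 K)[X] := X ^ P + C a with hf
  set g : K[X] := f.map (algebraMap (𝓞 K) K) with hg
  have hgirr : Irreducible g := irreducible_X_pow_add_C_of_mem_of_notMem_sq hP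
    (ha v₀ (Finset.mem_insert_self v₀ T)).1 (ha v₀ (Finset.mem_insert_self v₀ T)).2
  haveI : Fact (Irreducible g) := ⟨hgirr⟩
  have hgdeg : g.natDegree = P := by
    rw [hg, natDegree_map_eq_of_injective (FaithfulSMul.algebraMap_injective (𝓞 K) K), hf,
      natDegree_X_pow_add_C]
  let L := AdjoinRoot g
  let pb := AdjoinRoot.powerBasis hgirr.ne_zero
  haveI : FiniteDimensional K L := pb.finite
  haveI : CharZero L := charZero_of_injective_algebraMap (algebraMap K L).injective
  haveI : NumberField L :=
    { to_charZero := inferInstance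
      to_finiteDimensional := Module.Finite.trans K L }
  have hdeg : Module.finrank K L = P := by rw [pb.finrank, AdjoinRoot.powerBasis_dim, hgdeg]
  -- the root `α` of `g`: `α ^ P = -a`, and `-a ∈ v ∖ v²` for `v ∈ T`
  have hroot : aeval (AdjoinRoot.root g) g = 0 := AdjoinRoot.aeval_eq g ▸ AdjoinRoot.mk_self
  change aeval (AdjoinRoot.root g) (f.map (algebraMap (𝓞 K) K)) = 0 at hroot
  rw [aeval_map_algebraMap, hf, map_add, map_pow, aeval_X, aeval_C, add_eq_zero_iff_eq_neg]
    at hroot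
  have hα : (AdjoinRoot.root g) ^ P = algebraMap K L (algebraMap (𝓞 K) K (-a)) := by
    rw [hroot, map_neg, map_neg, ← IsScalarTower.algebraMap_apply]
  refine ⟨L, inferInstance, inferInstance, inferInstance, hdeg, fun v hv w _ ↦ ?_⟩
  have hav := ha v (Finset.mem_insert_of_mem hv)
  exact ramificationIdx_eq_of_pow_eq L hP hdeg hα v (v.asIdeal.neg_mem hav.1)
    (fun h ↦ hav.2 (by simpa using (v.asIdeal ^ 2).neg_mem h)) w

end NumberField

end Literature.NumberTheory.EllipticCurves

end
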